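import Summits.QuantumFields.BalabanUV.T4Continuum.Support.NE7FlatInteriorGradientModulus
import HarnessLib

/-!
# NE7FlatInteriorGradientModulusVec — THE INTERIOR C¹ ∕ LOG-LIPSCHITZ ∕ `C^{1,β<1}` LETTERS OF `NE7FlatInteriorGradientModulus` FOR VECTOR-VALUED LATTICE FUNCTIONS
# (any real normed space `E`: matrix-valued gauge potentials `B : ℤ^d → M_n(ℂ)` componentwise in the bond direction), by duality
# (file F3 of gen 112's line «flat interior C^{1,log-Lip} potential theory + (10) ⟹ (9)_{β<1}»)

Cell `pub-balaban`, rung (B)+1 sub-cell t4, lineage `b2b-balaban-t4-ne7-p1` (CRUX PROVER NE7 #1 = OWNER of BINDER row NE7), generation 112.  Memo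
`t4/b2b-balaban-t4-ne7-p1-g112/ROAD-G112.md`.  Pattern of NE7b g154∕g155 (`NE7FlatInteriorEstimateDivForm`): a real-linear functional `f` commutes with the flat lattice Laplacian
and with differences, the scalar letters apply to `f ∘ u` with data `A‖f‖`, `S‖f‖`, and `NormedSpace.norm_le_dual_bound` returns to the norm of `E`.
WHAT ([folklore]; 0 def, 0 sorry; every `d ≥ 3`, every real normed space `E`; constants existential in `d`, the SAME as the scalar letters').  With
`(Δu)(y) := Σ_μ[(u(y+e_μ) − u y) − (u y − u(y−e_μ))]` and the hypotheses `‖Δu‖ ≤ A`, `‖u‖ ≤ S` on `cube x (7m)` (`m ≥ 1`):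
`lap_dual_apply_vec`; **`interior_gradient_sup_vec`** (`‖u(y+e_j) − u(y)‖ ≤ C·(mA + S∕m)` on `cube x (3m+1)`); **`interior_gradient_modulus_vec`**
(`‖∇_μu(z) − ∇_μu(z′)‖ ≤ C·(A + S∕m²)·h·(1 + log⁺(3m∕h))` on `cube x (m−1)`, `h = |z − z′|_∞`); **`interior_gradient_holder_vec`** (`∀ β ∈ [0,1)`:
`≤ C·(1 + (1−β)⁻¹)·(A + S∕m²)·(3m)^{1−β}·h^β`).
HONEST FRAMING (page 1): flat `ℤ^d` potential theory; nothing of Bałaban's asserted; nothing about minimisers; NOT NE3∕NE7 as spine nodes; spine 0∕9; finite T⁴ rung (B)+1 —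
NOT infinite volume, NOT mass gap, NOT BetaPertH, NOT Clay (continuum YM on T⁴ ⇐ BetaPertH ∧ nine spine estimates).
-/

set_option autoImplicit false

open scoped BigOperators
open Finset

namespace Summit.QuantumFields.BalabanUV.T4Continuum.NE7FlatInteriorGradientModulusVec

open Literature.MathematicalPhysics.QuantumFieldTheory.Balaban1983to89
open B7Prop1Explicit (Site e)
open Literature.Probability.LatticeModels (latticeLaplacianZd latticeLaplacianZd_def)
open Beta.PoissonInterior (cube mem_cube supNorm)
open NE7FlatInteriorGradientModulus (interior_gradient_sup interior_gradient_modulus interior_gradient_holder)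

noncomputable section

variable {d : ℕ} {E : Type*} [NormedAddCommGroup E] [NormedSpace ℝ E]

/-! ## §1 Real functionals through the flat Laplacian -/

/-- The scalar Laplacian of a real-linear functional of a vector field is the functional of the componentwise Laplacian:
`Δ(f∘u)(y) = f(Σ_μ[(u(y+e_μ) − u y) − (u y − u(y−e_μ))])`. [folklore] -/
theorem lap_dual_apply_vec (f : E →L[ℝ] ℝ) (u : Site d → E) (y : Site d) :
    latticeLaplacianZd (fun z => f (u z)) y = f (∑ μ : Fin d, ((u (y + e μ) - u y) - (u y - u (y - e μ)))) := by
  rw [map_sum, latticeLaplacianZd_def]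
  have he : ∀ i : Fin d, (e i : Site d) = Pi.single i 1 := fun i => rfl
  have hsum : ∀ i : Fin d, f ((u (y + e i) - u y) - (u y - u (y - e i))) = (f (u (y + Pi.single i 1)) + f (u (y - Pi.single i 1))) - 2 * f (u y) := by
    intro i
    rw [map_sub, map_sub, map_sub, he]
    ring
  simp_rw [hsum]
  rw [Finset.sum_sub_distrib, Finset.sum_const, Finset.card_univ, Fintype.card_fin, nsmul_eq_mul]
  ring

/-- The scalar data of `f ∘ u`: `|Δ(f∘u)| ≤ A·‖f‖` and `|f∘u| ≤ S·‖f‖` wherever `‖Δu‖ ≤ A`, `‖u‖ ≤ S`. [folklore] -/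
theorem dual_data (f : E →L[ℝ] ℝ) (u : Site d → E) {T : Finset (Site d)} {A S : ℝ}
    (hA : ∀ y ∈ T, ‖∑ μ : Fin d, ((u (y + e μ) - u y) - (u y - u (y - e μ)))‖ ≤ A) (hS : ∀ y ∈ T, ‖u y‖ ≤ S) :
    (∀ y ∈ T, |latticeLaplacianZd (fun z => f (u z)) y| ≤ A * ‖f‖) ∧ (∀ y ∈ T, |f (u y)| ≤ S * ‖f‖) := by
  constructor
  · intro y hy
    rw [lap_dual_apply_vec, ← Real.norm_eq_abs]
    calc _ ≤ ‖f‖ * ‖∑ μ : Fin d, ((u (y + e μ) - u y) - (u y - u (y - e μ)))‖ := f.le_opNorm _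
      _ ≤ ‖f‖ * A := mul_le_mul_of_nonneg_left (hA y hy) (norm_nonneg _)
      _ = A * ‖f‖ := mul_comm _ _
  · intro y hy
    rw [← Real.norm_eq_abs]
    calc _ ≤ ‖f‖ * ‖u y‖ := f.le_opNorm _
      _ ≤ ‖f‖ * S := mul_le_mul_of_nonneg_left (hS y hy) (norm_nonneg _)
      _ = S * ‖f‖ := mul_comm _ _

/-! ## §2 The three letters for vector-valued lattice functions -/

/-- **INTERIOR GRADIENT BOUND, VECTOR-VALUED** (`d ≥ 3`): `∃ C ≥ 0` such that for `m ≥ 1`, if `‖Δu‖ ≤ A` and `‖u‖ ≤ S` on `cube x (7m)` then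
`‖u(y + e_j) − u(y)‖ ≤ C·(m·A + S∕m)` at every `y ∈ cube x (3m+1)`. [folklore] -/
theorem interior_gradient_sup_vec (hd : 3 ≤ d) : ∃ C : ℝ, 0 ≤ C ∧ ∀ (m : ℕ), 1 ≤ m →
    ∀ (u : Site d → E) (x : Site d) (A S : ℝ),
    (∀ y ∈ cube x (7 * m), ‖∑ μ : Fin d, ((u (y + e μ) - u y) - (u y - u (y - e μ)))‖ ≤ A) → (∀ y ∈ cube x (7 * m), ‖u y‖ ≤ S) →
    ∀ y ∈ cube x (3 * m + 1), ∀ j : Fin d, ‖u (y + e j) - u y‖ ≤ C * ((m : ℝ) * A + S / m) := by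
  obtain ⟨C, hC, h⟩ := interior_gradient_sup hd
  refine ⟨C, hC, fun m hm u x A S hA hS y hy j => ?_⟩
  have hA0 : 0 ≤ A := (norm_nonneg _).trans (hA x (by rw [mem_cube]; intro i; simp))
  have hS0 : 0 ≤ S := (norm_nonneg _).trans (hS x (by rw [mem_cube]; intro i; simp))
  have hM0 : 0 ≤ C * ((m : ℝ) * A + S / m) := by positivity
  refine NormedSpace.norm_le_dual_bound ℝ _ hM0 fun f => ?_
  obtain ⟨hAf, hSf⟩ := dual_data f u hA hS
  have key := h m hm (fun z => f (u z)) x (A * ‖f‖) (S * ‖f‖) hAf hSf y hy j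
  rw [Real.norm_eq_abs, map_sub]
  calc |f (u (y + e j)) - f (u y)| ≤ C * ((m : ℝ) * (A * ‖f‖) + S * ‖f‖ / m) := key
    _ = C * ((m : ℝ) * A + S / m) * ‖f‖ := by ring

/-- **THE INTERIOR LOG-LIPSCHITZ MODULUS OF THE GRADIENT, VECTOR-VALUED** (`d ≥ 3`): `∃ C ≥ 0` such that for `m ≥ 1`, if `‖Δu‖ ≤ A` and `‖u‖ ≤ S` on
`cube x (7m)` then for all `z, z′ ∈ cube x (m−1)` and every `μ` (`h := |z − z′|_∞`):
`‖(u(z + e_μ) − u(z)) − (u(z′ + e_μ) − u(z′))‖ ≤ C·(A + S∕m²)·h·(1 + log⁺(3m∕h))`. [folklore] -/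
theorem interior_gradient_modulus_vec (hd : 3 ≤ d) : ∃ C : ℝ, 0 ≤ C ∧ ∀ (m : ℕ), 1 ≤ m →
    ∀ (u : Site d → E) (x : Site d) (A S : ℝ),
    (∀ y ∈ cube x (7 * m), ‖∑ μ : Fin d, ((u (y + e μ) - u y) - (u y - u (y - e μ)))‖ ≤ A) → (∀ y ∈ cube x (7 * m), ‖u y‖ ≤ S) →
    ∀ (z z' : Site d), z ∈ cube x (m - 1) → z' ∈ cube x (m - 1) → ∀ μ : Fin d,
      ‖(u (z + e μ) - u z) - (u (z' + e μ) - u z')‖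
        ≤ C * (A + S / (m : ℝ) ^ 2) * (supNorm (z - z') : ℝ) * (1 + Real.posLog ((3 * m : ℝ) / supNorm (z - z'))) := by
  obtain ⟨C, hC, h⟩ := interior_gradient_modulus hd
  refine ⟨C, hC, fun m hm u x A S hA hS z z' hz hz' μ => ?_⟩
  have hA0 : 0 ≤ A := (norm_nonneg _).trans (hA x (by rw [mem_cube]; intro i; simp))
  have hS0 : 0 ≤ S := (norm_nonneg _).trans (hS x (by rw [mem_cube]; intro i; simp))
  have hP0 : 0 ≤ Real.posLog ((3 * m : ℝ) / supNorm (z - z')) := Real.posLog_nonneg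
  have hM0 : 0 ≤ C * (A + S / (m : ℝ) ^ 2) * (supNorm (z - z') : ℝ) * (1 + Real.posLog ((3 * m : ℝ) / supNorm (z - z'))) := by
    positivity
  refine NormedSpace.norm_le_dual_bound ℝ _ hM0 fun f => ?_
  obtain ⟨hAf, hSf⟩ := dual_data f u hA hS
  have key := h m hm (fun w => f (u w)) x (A * ‖f‖) (S * ‖f‖) hAf hSf z z' hz hz' μ
  rw [Real.norm_eq_abs, map_sub, map_sub, map_sub]
  calc |f (u (z + e μ)) - f (u z) - (f (u (z' + e μ)) - f (u z'))|
      ≤ C * (A * ‖f‖ + S * ‖f‖ / (m : ℝ) ^ 2) * (supNorm (z - z') : ℝ) * (1 + Real.posLog ((3 * m : ℝ) / supNorm (z - z'))) := key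
    _ = C * (A + S / (m : ℝ) ^ 2) * (supNorm (z - z') : ℝ) * (1 + Real.posLog ((3 * m : ℝ) / supNorm (z - z'))) * ‖f‖ := by ring

/-- **THE INTERIOR `C^{1,β}` ESTIMATE FOR EVERY `β < 1`, VECTOR-VALUED, UNIFORMLY IN `m`** (`d ≥ 3`): `∃ C ≥ 0` such that for `m ≥ 1`, if `‖Δu‖ ≤ A` and `‖u‖ ≤ S` on
`cube x (7m)` then for `0 ≤ β < 1`, all `z, z′ ∈ cube x (m−1)` and every `μ` (`h := |z − z′|_∞`):
`‖(u(z + e_μ) − u(z)) − (u(z′ + e_μ) − u(z′))‖ ≤ C·(1 + (1−β)⁻¹)·(A + S∕m²)·(3m)^{1−β}·h^β`.  Nothing is claimed at `β = 1`. [folklore] -/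
theorem interior_gradient_holder_vec (hd : 3 ≤ d) : ∃ C : ℝ, 0 ≤ C ∧ ∀ (m : ℕ), 1 ≤ m →
    ∀ (u : Site d → E) (x : Site d) (A S : ℝ),
    (∀ y ∈ cube x (7 * m), ‖∑ μ : Fin d, ((u (y + e μ) - u y) - (u y - u (y - e μ)))‖ ≤ A) → (∀ y ∈ cube x (7 * m), ‖u y‖ ≤ S) →
    ∀ (β : ℝ), 0 ≤ β → β < 1 →
    ∀ (z z' : Site d), z ∈ cube x (m - 1) → z' ∈ cube x (m - 1) → ∀ μ : Fin d,
      ‖(u (z + e μ) - u z) - (u (z' + e μ) - u z')‖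
        ≤ C * (1 + (1 - β)⁻¹) * (A + S / (m : ℝ) ^ 2) * (3 * m : ℝ) ^ (1 - β) * (supNorm (z - z') : ℝ) ^ β := by
  obtain ⟨C, hC, h⟩ := interior_gradient_holder hd
  refine ⟨C, hC, fun m hm u x A S hA hS β hβ0 hβ1 z z' hz hz' μ => ?_⟩
  have hA0 : 0 ≤ A := (norm_nonneg _).trans (hA x (by rw [mem_cube]; intro i; simp))
  have hS0 : 0 ≤ S := (norm_nonneg _).trans (hS x (by rw [mem_cube]; intro i; simp))
  have hε : 0 < 1 - β := by linarith
  have h1 : (0 : ℝ) ≤ (3 * m : ℝ) ^ (1 - β) := Real.rpow_nonneg (by positivity) _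
  have h2 : (0 : ℝ) ≤ (supNorm (z - z') : ℝ) ^ β := Real.rpow_nonneg (by positivity) _
  have hM0 : 0 ≤ C * (1 + (1 - β)⁻¹) * (A + S / (m : ℝ) ^ 2) * (3 * m : ℝ) ^ (1 - β) * (supNorm (z - z') : ℝ) ^ β := by
    have : (0 : ℝ) ≤ 1 + (1 - β)⁻¹ := by positivity
    positivity
  refine NormedSpace.norm_le_dual_bound ℝ _ hM0 fun f => ?_
  obtain ⟨hAf, hSf⟩ := dual_data f u hA hS
  have key := h m hm (fun w => f (u w)) x (A * ‖f‖) (S * ‖f‖) hAf hSf β hβ0 hβ1 z z' hz hz' μ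
  rw [Real.norm_eq_abs, map_sub, map_sub, map_sub]
  calc |f (u (z + e μ)) - f (u z) - (f (u (z' + e μ)) - f (u z'))|
      ≤ C * (1 + (1 - β)⁻¹) * (A * ‖f‖ + S * ‖f‖ / (m : ℝ) ^ 2) * (3 * m : ℝ) ^ (1 - β) * (supNorm (z - z') : ℝ) ^ β := key
    _ = C * (1 + (1 - β)⁻¹) * (A + S / (m : ℝ) ^ 2) * (3 * m : ℝ) ^ (1 - β) * (supNorm (z - z') : ℝ) ^ β * ‖f‖ := by ring

end

end Summit.QuantumFields.BalabanUV.T4Continuum.NE7FlatInteriorGradientModulusVec
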